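import Mathlib
import HarnessLib

/-!
# NE7SecondOrderChainRuleVec — SECOND DERIVATIVES OF COMPOSITIONS, VECTOR-VALUED, AND THE SECOND-ORDER CONSTRAINT IDENTITY (calculus letters for the bordered Hessian of the
# constrained minimal action at a general datum, ROAD-G115 §5 (iii))

Pure calculus over real normed spaces ([folklore]; 0 def, 0 sorry): for `f : S → F` (vector-valued) and `Θ : E → S` both `C²`,
`D²(f∘Θ)(x)[u,u′] = D²f(Θx)[DΘ(x)u, DΘ(x)u′] + Df(Θx)[D²Θ(x)[u,u′]]` (**`fderiv_fderiv_comp_vec`**; the real-valued case is ✓ `NE7SecondOrderChainRule.fderiv_fderiv_comp`); along a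
continuous linear map `D²(f∘ℓ)(x)[u,u′] = D²f(ℓx)[ℓu, ℓu′]` (**`fderiv_fderiv_comp_clm_vec`**); a curve that is LINEAR near `0` has vanishing second derivative
(**`fderiv_fderiv_eq_zero_of_eventuallyEq_smul`**); and THE SECOND-ORDER CONSTRAINT IDENTITY (**`fderiv_apply_second_eq_neg`**): if `𝒢 : S → Y` is `C²` at `c 0`, `c : ℝ → S` is `C²` at `0`
and `𝒢(c t) = t•v` near `0`, then `D𝒢(c 0)[c″(0)] = −D²𝒢(c 0)[c′(0), c′(0)]` — the term by which the Hessian of a constrained minimum differs from the Hessian of the objective (the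
Lagrange-multiplier ∕ bordered-Hessian correction).
Cell `pub-balaban`, rung (B)+1 sub-cell t4, lineage `b2b-balaban-t4-ne7-p1` (CRUX PROVER NE7 #1 = OWNER of BINDER row NE7), generation 115.  Memo `t4/b2b-balaban-t4-ne7-p1-g115/ROAD-G115.md` §5.
HONEST FRAMING (page 1): a calculus letter; nothing of Bałaban's asserted; NOT NE7, NOT NE3; spine 0∕9; NOT infinite volume, NOT mass gap, NOT BetaPertH, NOT Clay.
-/

set_option autoImplicit false

open scoped Topology
open Filter Set ContinuousLinearMap

namespace Summit.QuantumFields.BalabanUV.T4Continuum.NE7SecondOrderChainRuleVec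

variable {E S F : Type*} [NormedAddCommGroup E] [NormedSpace ℝ E] [NormedAddCommGroup S] [NormedSpace ℝ S] [NormedAddCommGroup F] [NormedSpace ℝ F]

/-- **SECOND-ORDER CHAIN RULE, VECTOR-VALUED**: for `f : S → F` `C²` at `Θ x` and `Θ : E → S` `C²` at `x`,
`D²(f∘Θ)(x)[u,u′] = D²f(Θ x)[DΘ(x)u, DΘ(x)u′] + Df(Θ x)[D²Θ(x)[u,u′]]`. [folklore] -/
theorem fderiv_fderiv_comp_vec {f : S → F} {Θ : E → S} {x : E} (hf : ContDiffAt ℝ 2 f (Θ x)) (hΘ : ContDiffAt ℝ 2 Θ x) (u u' : E) :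
    fderiv ℝ (fderiv ℝ (fun y : E => f (Θ y))) x u u'
      = fderiv ℝ (fderiv ℝ f) (Θ x) (fderiv ℝ Θ x u) (fderiv ℝ Θ x u') + fderiv ℝ f (Θ x) (fderiv ℝ (fderiv ℝ Θ) x u u') := by
  have hΘd : ∀ᶠ y : E in 𝓝 x, DifferentiableAt ℝ Θ y :=
    (hΘ.eventually (by simp)).mono fun y hy => hy.differentiableAt (by simp)
  have hfd' : ∀ᶠ s : S in 𝓝 (Θ x), DifferentiableAt ℝ f s :=
    (hf.eventually (by simp)).mono fun s hs => hs.differentiableAt (by simp)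
  have hfd : ∀ᶠ y : E in 𝓝 x, DifferentiableAt ℝ f (Θ y) := hΘ.continuousAt.eventually hfd'
  have hev : fderiv ℝ (fun y : E => f (Θ y)) =ᶠ[𝓝 x] fun y : E => (fderiv ℝ f (Θ y)).comp (fderiv ℝ Θ y) := by
    filter_upwards [hΘd, hfd] with y hΘy hfy
    exact fderiv_comp y hfy hΘy
  have hc : HasFDerivAt (fun y : E => fderiv ℝ f (Θ y)) ((fderiv ℝ (fderiv ℝ f) (Θ x)).comp (fderiv ℝ Θ x)) x :=
    ((hf.fderiv_right (by norm_num)).differentiableAt one_ne_zero).hasFDerivAt.comp x (hΘ.differentiableAt (by simp)).hasFDerivAt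
  have hd : HasFDerivAt (fun y : E => fderiv ℝ Θ y) (fderiv ℝ (fderiv ℝ Θ) x) x :=
    ((hΘ.fderiv_right (by norm_num)).differentiableAt one_ne_zero).hasFDerivAt
  rw [hev.fderiv_eq, (hc.clm_comp hd).fderiv]
  simp only [add_apply, ContinuousLinearMap.comp_apply, compL_apply, flip_apply]
  rw [add_comm]

/-- **SECOND DERIVATIVE ALONG A CONTINUOUS LINEAR MAP, VECTOR-VALUED**: `D²(f∘ℓ)(x)[u,u′] = D²f(ℓ x)[ℓ u, ℓ u′]`. [folklore] -/
theorem fderiv_fderiv_comp_clm_vec {f : S → F} (ℓ : E →L[ℝ] S) {x : E} (hf : ContDiffAt ℝ 2 f (ℓ x)) (u u' : E) :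
    fderiv ℝ (fderiv ℝ (fun y : E => f (ℓ y))) x u u' = fderiv ℝ (fderiv ℝ f) (ℓ x) (ℓ u) (ℓ u') := by
  rw [fderiv_fderiv_comp_vec hf ℓ.contDiff.contDiffAt, ℓ.fderiv]
  have h2 : fderiv ℝ (fderiv ℝ (⇑ℓ : E → S)) x = 0 := by
    have h : fderiv ℝ (⇑ℓ : E → S) = fun _ : E => ℓ := by funext y; exact ℓ.fderiv
    rw [h, fderiv_const_apply]
  rw [h2, zero_apply, zero_apply, map_zero, add_zero]

/-- A curve which is LINEAR near `0` has vanishing second derivative there: if `c t = t • v` near `0` then `D²c(0) = 0`. [folklore] -/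
theorem fderiv_fderiv_eq_zero_of_eventuallyEq_smul {c : ℝ → F} {v : F} (hc : c =ᶠ[𝓝 0] fun t : ℝ => t • v) :
    fderiv ℝ (fderiv ℝ c) 0 = 0 := by
  have hℓ : ∀ t : ℝ, HasFDerivAt (fun s : ℝ => s • v) (toSpanSingleton ℝ v) t := fun t => by
    have h := (toSpanSingleton ℝ v).hasFDerivAt (x := t)
    have e : (⇑(toSpanSingleton ℝ v) : ℝ → F) = fun s : ℝ => s • v := by funext s; exact toSpanSingleton_apply ℝ v s
    rwa [e] at h
  have hev : fderiv ℝ c =ᶠ[𝓝 0] fun _ : ℝ => toSpanSingleton ℝ v := by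
    filter_upwards [hc.eventuallyEq_nhds] with t ht
    rw [ht.fderiv_eq, (hℓ t).fderiv]
  rw [hev.fderiv_eq, fderiv_const_apply]

/-- **THE SECOND-ORDER CONSTRAINT IDENTITY** (see the module docstring): if `𝒢 : S → Y` is `C²` at `c 0`, `c : ℝ → S` is `C²` at `0` and `𝒢 (c t) = t • v` near `0`, then
`D𝒢(c 0)[D²c(0)[1,1]] = −D²𝒢(c 0)[Dc(0)1, Dc(0)1]`. [folklore] -/
theorem fderiv_apply_second_eq_neg {Y : Type*} [NormedAddCommGroup Y] [NormedSpace ℝ Y] {𝒢 : S → Y} {c : ℝ → S} {v : Y}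
    (h𝒢 : ContDiffAt ℝ 2 𝒢 (c 0)) (hcc : ContDiffAt ℝ 2 c 0) (hlin : (fun t : ℝ => 𝒢 (c t)) =ᶠ[𝓝 0] fun t : ℝ => t • v) :
    fderiv ℝ 𝒢 (c 0) (fderiv ℝ (fderiv ℝ c) 0 1 1) = -(fderiv ℝ (fderiv ℝ 𝒢) (c 0) (fderiv ℝ c 0 1) (fderiv ℝ c 0 1)) := by
  have h0 : fderiv ℝ (fderiv ℝ (fun t : ℝ => 𝒢 (c t))) 0 1 1 = 0 := by
    rw [fderiv_fderiv_eq_zero_of_eventuallyEq_smul hlin, zero_apply, zero_apply]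
  rw [fderiv_fderiv_comp_vec h𝒢 hcc] at h0
  exact eq_neg_of_add_eq_zero_right h0

end Summit.QuantumFields.BalabanUV.T4Continuum.NE7SecondOrderChainRuleVec
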